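import Mathlib
import HarnessLib
import Summits.HubbardSuperconductivity.HubbardSuperconductivity.Theorems.KLProgrammeKLRegimeEngineDressedAliasing
import Summits.HubbardSuperconductivity.HubbardSuperconductivity.Theorems.KLProgrammeFermiSurfaceFST2Constants

/-!
# K3 gen-8-FLOW (stmt 20437, stub (C), «(C)-B-LAST», generic layer 3′): THE DRESSED ALIASING LEMMA WITHOUT VANISHING — for lattice data
# `f(k) = Re(g(p_k)·H(k))` with `g` smooth `2π`-periodic `D₄`-symmetric (NOT assumed to vanish near `q`) and `H` any lattice factor with moments,
# `‖Dʲ[evalM (symInterp L f)](q)‖ ≤ 2·2ʲ·D_q·M_j(H) + [the pure-aliasing bound of layer 3]`, `D_q = max_{i ≤ j} ‖Dⁱg(q)‖`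

Cell gate-hubbard-kl, seat p2 g15 (successor item «(C)-B-LAST» of HOME/HANDOFF «p2 g14» FINAL: the LAST flow step `m = n_β`, where
`Λ_m ∈ [π/β, 4π/β]` and the reading point is NOT below the shell — the dressing factors `d, J₁, J₂` of the (B) door no longer vanish near `q`, so layer 3
(`norm_iteratedFDeriv_evalM_symInterp_dressed_le`, p578694, hypothesis `hvan`) does not apply).  c4a-1's generic lemma
(`norm_iteratedFDeriv_evalM_symInterp_mul_trigPoly_le`, p575152) keeps the continuum term `‖Dʲ(g·P)(q)‖`; here it is BOUNDED instead of vanishing: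
Leibniz + the jets of the near cosine polynomial `P(q) = Σ_y c_y cos(y·q)` in the `(B,c)` currency (`‖DᵏP(q)‖ ≤ Σ_y |c_y|(1+|y₀|+|y₁|)ᵏ`) give
`‖Dʲ(g·P)(q)‖ ≤ 2ʲ·D_q·Σ_y|c_y|(1+|y₀|+|y₁|)ʲ ≤ 2ʲ·D_q·M_j(H)` for `‖Dⁱg(q)‖ ≤ D_q` (`i ≤ j`).  Everything else is layer 3 verbatim.

* §1 `norm_iteratedFDeriv_cos_planeWave_le` — `‖Dᵏ(q ↦ cos(Σᵢ yᵢqᵢ))‖ ≤ (|y₀|+|y₁|)ᵏ`; `norm_iteratedFDeriv_cosPoly_le` — the `(B,c)` polynomial's jets;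
* §2 `norm_iteratedFDeriv_mul_cosPoly_le` — `‖Dʲ(g·P)(q)‖ ≤ 2ʲ·D_q·Σ_y|c_y|(1+|y₀|+|y₁|)ʲ`;
* §3 **`norm_iteratedFDeriv_evalM_symInterp_dressed_le_of_jets`** — THE LAST-SCALE DRESSED ALIASING LEMMA:
  `≤ 2·(2ʲ·D_q·M_j) + 2·(2·M_j·(3ʲ·D_g·(2/N)^{M−j−4}·4C₂)) + L²Lʲ·A₀·M_s/(1+L/4)ˢ`.

The first summand is NOT `tiny(L)`: at the last scale the tree/dressing channel contributes a genuine `O(‖dressing‖·moments)` term — the input the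
model layer «(C)-B-LAST» (successor) pairs with the reading's renormalisation condition near `γ_{K_{m+1}}`.  Pure harmonic analysis; nothing about the Hubbard
model is asserted; nothing asserts superconductivity.  References: BGM 2006 §2.3 (2.17) [cite: BenfattoGiulianiMastropietro2006]; Boyd 2001 §4.5 Thm 19–20
[cite: Boyd2001]; Grafakos 2014 §3.3.3 [cite: Grafakos2014].
-/

noncomputable section

namespace Summit.HubbardSuperconductivity.HubbardSuperconductivity.Theorems.EngineV8

set_option linter.dupNamespace false -- summit = problem name (single-conjunct summit), D-0017

open Real Finset Filter Literature.MathematicalPhysics.QuantumLattice Literature.Probability.LatticeModels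
open Summit.HubbardSuperconductivity.HubbardSuperconductivity.Theorems.KLRegimeSplit
open Summit.HubbardSuperconductivity.HubbardSuperconductivity.Theorems.C4a
open scoped ComplexConjugate

variable {L : ℕ} [NeZero L]

/-! ## §1 Jets of plane-wave cosines and of `(B,c)` cosine polynomials -/

section CosJets

omit [NeZero L]

/-- **`‖Dᵏ(q ↦ cos(Σᵢ yᵢ qᵢ))(q)‖ ≤ (|y₀| + |y₁|)ᵏ`** (composition of `cos` with the linear form `q ↦ y·q`, of operator norm `≤ |y₀|+|y₁|`). -/
theorem norm_iteratedFDeriv_cos_planeWave_le (y : Fin 2 → ℤ) (k : ℕ) (q : Momentum) :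
    ‖iteratedFDeriv ℝ k (fun q : Momentum => Real.cos (∑ i : Fin 2, (y i : ℝ) * q i)) q‖ ≤ (|((y 0 : ℤ) : ℝ)| + |((y 1 : ℤ) : ℝ)|) ^ k := by
  set Lf : Momentum →L[ℝ] ℝ := ∑ i : Fin 2, ((y i : ℤ) : ℝ) • (PiLp.proj 2 (fun _ : Fin 2 => ℝ) i : Momentum →L[ℝ] ℝ) with hLf
  have hfun : (fun q : Momentum => Real.cos (∑ i : Fin 2, (y i : ℝ) * q i)) = Real.cos ∘ Lf := by
    funext q
    simp [hLf]
  have hnL : ‖Lf‖ ≤ |((y 0 : ℤ) : ℝ)| + |((y 1 : ℤ) : ℝ)| := by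
    rw [hLf, Fin.sum_univ_two]
    refine (norm_add_le _ _).trans (add_le_add ?_ ?_)
    · rw [norm_smul, Real.norm_eq_abs]
      exact mul_le_of_le_one_right (abs_nonneg _) (Summit.HubbardSuperconductivity.HubbardSuperconductivity.Theorems.klfs_norm_proj_le 0)
    · rw [norm_smul, Real.norm_eq_abs]
      exact mul_le_of_le_one_right (abs_nonneg _) (Summit.HubbardSuperconductivity.HubbardSuperconductivity.Theorems.klfs_norm_proj_le 1)
  rw [hfun, ContinuousLinearMap.iteratedFDeriv_comp_right Lf Real.contDiff_cos q (i := k) le_top]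
  refine (ContinuousMultilinearMap.norm_compContinuousLinearMap_le _ _).trans ?_
  rw [Finset.prod_const, Finset.card_univ, Fintype.card_fin, norm_iteratedFDeriv_eq_norm_iteratedDeriv, Real.norm_eq_abs]
  calc |iteratedDeriv k Real.cos (Lf q)| * ‖Lf‖ ^ k ≤ 1 * (|((y 0 : ℤ) : ℝ)| + |((y 1 : ℤ) : ℝ)|) ^ k :=
        mul_le_mul (Real.abs_iteratedDeriv_cos_le_one k _) (pow_le_pow_left₀ (norm_nonneg _) hnL k) (by positivity) zero_le_one
    _ = _ := one_mul _

/-- Plane-wave cosines are smooth. -/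
theorem contDiff_cos_planeWave (y : Fin 2 → ℤ) {n : WithTop ℕ∞} : ContDiff ℝ n (fun q : Momentum => Real.cos (∑ i : Fin 2, (y i : ℝ) * q i)) :=
  Real.contDiff_cos.comp (ContDiff.sum fun i _ => contDiff_const.mul (EuclideanSpace.proj (𝕜 := ℝ) i).contDiff)

/-- **Jets of a `(B,c)` cosine polynomial**: `‖Dᵏ(q ↦ Σ_{y∈B} c_y cos(y·q))(q)‖ ≤ Σ_{y∈B} |c_y|·(1+|y₀|+|y₁|)ᵏ`. -/
theorem norm_iteratedFDeriv_cosPoly_le (B : Finset (Fin 2 → ℤ)) (c : (Fin 2 → ℤ) → ℝ) (k : ℕ) (q : Momentum) :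
    ‖iteratedFDeriv ℝ k (fun q : Momentum => ∑ y ∈ B, c y * Real.cos (∑ i : Fin 2, (y i : ℝ) * q i)) q‖ ≤
      ∑ y ∈ B, |c y| * (1 + |((y 0 : ℤ) : ℝ)| + |((y 1 : ℤ) : ℝ)|) ^ k := by
  have hterm : ∀ y ∈ B, ContDiff ℝ k (fun q : Momentum => c y * Real.cos (∑ i : Fin 2, (y i : ℝ) * q i)) :=
    fun y _ => contDiff_const.mul (contDiff_cos_planeWave y)
  rw [iteratedFDeriv_sum hterm, Finset.sum_apply]
  refine (norm_sum_le _ _).trans (sum_le_sum fun y hy => ?_)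
  have hsm : (fun q : Momentum => c y * Real.cos (∑ i : Fin 2, (y i : ℝ) * q i)) = c y • (fun q : Momentum => Real.cos (∑ i : Fin 2, (y i : ℝ) * q i)) := by
    funext q; rfl
  rw [hsm, iteratedFDeriv_const_smul_apply ((contDiff_cos_planeWave y).contDiffAt), norm_smul, Real.norm_eq_abs]
  refine mul_le_mul_of_nonneg_left ((norm_iteratedFDeriv_cos_planeWave_le y k q).trans ?_) (abs_nonneg _)
  exact pow_le_pow_left₀ (by positivity) (by linarith [abs_nonneg ((y 0 : ℤ) : ℝ)]) k

end CosJets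

/-! ## §2 Leibniz at the reading point -/

section Leibniz

omit [NeZero L]

/-- **`‖Dʲ(g·P)(q)‖ ≤ 2ʲ·D_q·Σ_y|c_y|(1+|y₀|+|y₁|)ʲ`** for a smooth real `g` with `‖Dⁱg(q)‖ ≤ D_q` (`i ≤ j`) and a `(B,c)` cosine polynomial `P`. -/
theorem norm_iteratedFDeriv_mul_cosPoly_le {g : Momentum → ℝ} (hg : ContDiff ℝ (⊤ : ℕ∞) g) (B : Finset (Fin 2 → ℤ)) (c : (Fin 2 → ℤ) → ℝ)
    {P : Momentum → ℝ} (hP : ∀ q : Momentum, P q = ∑ y ∈ B, c y * Real.cos (∑ i : Fin 2, (y i : ℝ) * q i))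
    {j : ℕ} {q : Momentum} {Dq : ℝ} (hDq : ∀ i ≤ j, ‖iteratedFDeriv ℝ i g q‖ ≤ Dq) :
    ‖iteratedFDeriv ℝ j (fun q => g q * P q) q‖ ≤ 2 ^ j * Dq * ∑ y ∈ B, |c y| * (1 + |((y 0 : ℤ) : ℝ)| + |((y 1 : ℤ) : ℝ)|) ^ j := by
  have hPfun : P = fun q : Momentum => ∑ y ∈ B, c y * Real.cos (∑ i : Fin 2, (y i : ℝ) * q i) := funext hP
  have hP' : ContDiff ℝ (⊤ : ℕ∞) P := by
    rw [hPfun]; exact ContDiff.sum fun y _ => contDiff_const.mul (contDiff_cos_planeWave y)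
  have hN : ((j : ℕ∞) : WithTop ℕ∞) ≤ ((⊤ : ℕ∞) : WithTop ℕ∞) := by exact_mod_cast le_top
  have hDq0 : 0 ≤ Dq := (norm_nonneg _).trans (hDq 0 (Nat.zero_le _))
  set Mk : ℕ → ℝ := fun k => ∑ y ∈ B, |c y| * (1 + |((y 0 : ℤ) : ℝ)| + |((y 1 : ℤ) : ℝ)|) ^ k with hMk
  have hMk_mono : ∀ k ≤ j, Mk k ≤ Mk j := by
    intro k hk
    refine sum_le_sum fun y _ => mul_le_mul_of_nonneg_left ?_ (abs_nonneg _)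
    exact pow_le_pow_right₀ (by linarith [abs_nonneg ((y 0 : ℤ) : ℝ), abs_nonneg ((y 1 : ℤ) : ℝ)]) hk
  have hMk0 : ∀ k, 0 ≤ Mk k := fun k => sum_nonneg fun y _ => by positivity
  refine (norm_iteratedFDeriv_mul_le hg hP' q hN).trans ?_
  have hterm : ∀ i ∈ range (j + 1), (j.choose i : ℝ) * ‖iteratedFDeriv ℝ i g q‖ * ‖iteratedFDeriv ℝ (j - i) P q‖ ≤ (j.choose i : ℝ) * (Dq * Mk j) := by
    intro i hi
    have hij : i ≤ j := Nat.lt_succ_iff.1 (mem_range.1 hi)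
    have h1 := hDq i hij
    have h2 : ‖iteratedFDeriv ℝ (j - i) P q‖ ≤ Mk j := by
      rw [hPfun]; exact (norm_iteratedFDeriv_cosPoly_le B c (j - i) q).trans (hMk_mono (j - i) (Nat.sub_le _ _))
    calc (j.choose i : ℝ) * ‖iteratedFDeriv ℝ i g q‖ * ‖iteratedFDeriv ℝ (j - i) P q‖
        = (j.choose i : ℝ) * (‖iteratedFDeriv ℝ i g q‖ * ‖iteratedFDeriv ℝ (j - i) P q‖) := by ring
      _ ≤ (j.choose i : ℝ) * (Dq * Mk j) := by gcongr
  refine (sum_le_sum hterm).trans (le_of_eq ?_)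
  rw [← sum_mul, ← Nat.cast_sum, Nat.sum_range_choose]
  push_cast
  ring

end Leibniz

/-! ## §3 The last-scale dressed aliasing lemma -/

section Last

/-- **THE LAST-SCALE DRESSED ALIASING LEMMA (no vanishing).**  `g : Momentum → ℂ` smooth, `2π`-periodic in each coordinate, reflection- and swap-symmetric,
with `‖D^M g‖ ≤ D_g` everywhere (`4 + j ≤ M`), `‖g‖ ≤ A₀`, and JETS AT THE READING POINT `‖Dⁱg(q)‖ ≤ D_q` (`i ≤ j`); `H` ANY lattice factor with position moments
`Σ_x (1+|x̃₀|+|x̃₁|)ʲ‖𝔉⁻¹H(x)‖ ≤ M_j`, `Σ_x (1+|x̃₀|+|x̃₁|)ˢ‖𝔉⁻¹H(x)‖ ≤ M_s`.  Then the `j`-th momentum jet at `q` of the symmetrised interpolant of the dressed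
data `k ↦ Re(g(p_k)·H(k))` is the Leibniz term at `q` plus pure aliasing:
`‖Dʲ[evalM (symInterp L Re(g∘p·H))](q)‖ ≤ (2·(2ʲ·D_q·M_j) + 2·(2·M_j·(3ʲ·D_g·(2/N)^{M−j−4}·(4·C₂)))) + L²·Lʲ·(A₀·M_s/(1+L/4)ˢ)`, `N = 2(L/4+1)`.
[cite: BenfattoGiulianiMastropietro2006, §2.3 (2.17)] -/
theorem norm_iteratedFDeriv_evalM_symInterp_dressed_le_of_jets {g : Momentum → ℂ}
    (hgper : ∀ (i : Fin 2) (q : Momentum), g (q + EuclideanSpace.single i (2 * π)) = g q) (hg : ContDiff ℝ (⊤ : ℕ∞) g)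
    (hrefl : ∀ p : Fin 2 → ℝ, g (WithLp.toLp 2 ![p 0, -p 1]) = g (WithLp.toLp 2 p))
    (hswap : ∀ p : Fin 2 → ℝ, g (WithLp.toLp 2 ![p 1, p 0]) = g (WithLp.toLp 2 p))
    (H : TorusSite 2 L → ℂ) {j M : ℕ} (hM : 4 + j ≤ M) {Dg : ℝ} (hDg : ∀ q, ‖iteratedFDeriv ℝ M g q‖ ≤ Dg) {A₀ : ℝ} (hA₀ : ∀ q, ‖g q‖ ≤ A₀)
    {Mj : ℝ} (hMj : ∑ x : TorusSite 2 L, (1 + ((x 0).valMinAbs.natAbs : ℝ) + ((x 1).valMinAbs.natAbs : ℝ)) ^ j * ‖torusFourierInv H x‖ ≤ Mj)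
    {s : ℕ} {Ms : ℝ} (hMs : ∑ x : TorusSite 2 L, (1 + ((x 0).valMinAbs.natAbs : ℝ) + ((x 1).valMinAbs.natAbs : ℝ)) ^ s * ‖torusFourierInv H x‖ ≤ Ms)
    {q : Momentum} {Dq : ℝ} (hDq : ∀ i ≤ j, ‖iteratedFDeriv ℝ i g q‖ ≤ Dq) :
    ‖iteratedFDeriv ℝ j (evalM (symInterp L (fun k : TorusSite 2 L => (g (WithLp.toLp 2 (latticeMomentum L k)) * H k).re))) q‖ ≤
      (2 * (2 ^ j * Dq * Mj) + 2 * (2 * (Mj * ((3 : ℝ) ^ j * Dg * (2 / ((2 * (L / 4 + 1) : ℕ) : ℝ)) ^ (M - j - 4) *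
        (2 ^ 2 * ∑' k : Fin 2 → ℤ, ∏ i, (1 + (k i : ℝ) ^ 2)⁻¹))))) +
        (L : ℝ) ^ 2 * (L : ℝ) ^ j * (A₀ * (Ms / (1 + (L : ℝ) / 4) ^ s)) := by
  classical
  -- names
  set G : TorusSite 2 L → ℂ := fun k => g (WithLp.toLp 2 (latticeMomentum L k)) with hG
  set near : Finset (TorusSite 2 L) := univ.filter (fun x : TorusSite 2 L => ∀ i, 4 * |(x i).valMinAbs| ≤ (L : ℤ)) with hnear
  set far : Finset (TorusSite 2 L) := univ.filter (fun x : TorusSite 2 L => ¬ ∀ i, 4 * |(x i).valMinAbs| ≤ (L : ℤ)) with hfar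
  set gre : Momentum → ℝ := fun q => (g q).re with hgre
  set gim : Momentum → ℝ := fun q => (g q).im with hgim
  set P₁ : Momentum → ℝ := fun q => ∑ x ∈ near, (torusFourierInv H x).re * TrigPolyC4v.harmonic (x 0).valMinAbs.natAbs (x 1).valMinAbs.natAbs (WithLp.ofLp q)
    with hP₁
  set P₂ : Momentum → ℝ := fun q => ∑ x ∈ near, (torusFourierInv H x).im * TrigPolyC4v.harmonic (x 0).valMinAbs.natAbs (x 1).valMinAbs.natAbs (WithLp.ofLp q)
    with hP₂
  set ffar : TorusSite 2 L → ℝ := fun k => ∑ x ∈ far, (G k * torusFourierInv H x).re *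
    TrigPolyC4v.harmonic (x 0).valMinAbs.natAbs (x 1).valMinAbs.natAbs (latticeMomentum L k) with hffar
  -- `G` is `B₂`-invariant
  have hGn : ∀ k, G (-k) = G k := fun k => sample_comp_neg hgper hrefl hswap k
  have hGr : ∀ k, G ![k 0, -k 1] = G k := fun k => sample_comp_reflect hgper hrefl k
  have hGs : ∀ k, G ![k 1, k 0] = G k := fun k => sample_comp_swap (L := L) hswap k
  -- the data split: `Re(G·H) ↦ (Re g·P₁ − Im g·P₂)∘p + far`, under the interpolant
  have hsplit : ∀ k : TorusSite 2 L, (∑ x : TorusSite 2 L, (G k * torusFourierInv H x).re *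
      TrigPolyC4v.harmonic (x 0).valMinAbs.natAbs (x 1).valMinAbs.natAbs (latticeMomentum L k)) =
      ((fun q => gre q * P₁ q) (WithLp.toLp 2 (latticeMomentum L k)) - (fun q => gim q * P₂ q) (WithLp.toLp 2 (latticeMomentum L k))) + ffar k := by
    intro k
    rw [← sum_filter_add_sum_filter_not univ (fun x : TorusSite 2 L => ∀ i, 4 * |(x i).valMinAbs| ≤ (L : ℤ))]
    simp only [hgre, hgim, hP₁, hP₂, hffar, hG, mul_sum, ← sum_sub_distrib]
    congr 1
    refine sum_congr rfl fun x _ => ?_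
    rw [Complex.mul_re]
    ring
  have hfun : evalM (symInterp L (fun k : TorusSite 2 L => (g (WithLp.toLp 2 (latticeMomentum L k)) * H k).re)) = fun q' =>
      (evalM (symInterp L (fun k => (fun q => gre q * P₁ q) (WithLp.toLp 2 (latticeMomentum L k)))) q' -
        evalM (symInterp L (fun k => (fun q => gim q * P₂ q) (WithLp.toLp 2 (latticeMomentum L k)))) q') +
        evalM (symInterp L ffar) q' := by
    funext q'
    rw [evalM_apply, eval_symInterp_dressed_eq_harmonics G H hGn hGr hGs]
    simp_rw [hsplit]
    rw [eval_symInterp_add L _ ffar, eval_symInterp_sub L]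
    rfl
  -- smoothness of the three interpolants and the splitting of the jet
  have hN : ((j : ℕ∞) : WithTop ℕ∞) ≤ ((⊤ : ℕ∞) : WithTop ℕ∞) := by exact_mod_cast le_top
  have hc1 : ContDiff ℝ j (evalM (symInterp L (fun k => (fun q => gre q * P₁ q) (WithLp.toLp 2 (latticeMomentum L k))))) := contDiff_evalM _
  have hc2 : ContDiff ℝ j (evalM (symInterp L (fun k => (fun q => gim q * P₂ q) (WithLp.toLp 2 (latticeMomentum L k))))) := contDiff_evalM _
  have hc3 : ContDiff ℝ j (evalM (symInterp L ffar)) := contDiff_evalM _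
  rw [hfun, fun_iteratedFDeriv_add_apply (hc1.sub hc2).contDiffAt hc3.contDiffAt, fun_iteratedFDeriv_sub_apply hc1.contDiffAt hc2.contDiffAt]
  refine (norm_add_le _ _).trans (add_le_add ((norm_sub_le _ _).trans ?_) ?_)
  · -- the two main terms through c4a-1's generic lemma
    have hgre_per : ∀ (i : Fin 2) (q : Momentum), gre (q + EuclideanSpace.single i (2 * π)) = gre q := fun i q => by
      simp only [hgre, hgper]
    have hgim_per : ∀ (i : Fin 2) (q : Momentum), gim (q + EuclideanSpace.single i (2 * π)) = gim q := fun i q => by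
      simp only [hgim, hgper]
    have hgre_sm : ContDiff ℝ (⊤ : ℕ∞) gre := Complex.reCLM.contDiff.comp hg
    have hgim_sm : ContDiff ℝ (⊤ : ℕ∞) gim := Complex.imCLM.contDiff.comp hg
    have hDre : ∀ q, ‖iteratedFDeriv ℝ M gre q‖ ≤ Dg := fun q => ((norm_iteratedFDeriv_re_im_le hg M q).1).trans (hDg q)
    have hDim : ∀ q, ‖iteratedFDeriv ℝ M gim q‖ ≤ Dg := fun q => ((norm_iteratedFDeriv_re_im_le hg M q).2).trans (hDg q)
    have hflat_re : ∀ (i : Fin 2) (t : UnitAddTorus (Fin 2)),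
        ‖((Literature.Analysis.FunctionSpaces.Torus.partialDeriv i)^[M] (symbolFlat gre hgre_per)) t‖ ≤ (2 * π) ^ M * Dg :=
      norm_partialDeriv_iterate_symbolFlat_le hgre_per hgre_sm hDre
    have hflat_im : ∀ (i : Fin 2) (t : UnitAddTorus (Fin 2)),
        ‖((Literature.Analysis.FunctionSpaces.Torus.partialDeriv i)^[M] (symbolFlat gim hgim_per)) t‖ ≤ (2 * π) ^ M * Dg :=
      norm_partialDeriv_iterate_symbolFlat_le hgim_per hgim_sm hDim
    have hw_re := summable_weighted_symbolFlat_of_deriv hgre_per hgre_sm hM hflat_re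
    have hw_im := summable_weighted_symbolFlat_of_deriv hgim_per hgim_sm hM hflat_im
    have hG_re := quarterTail_weighted_le (L := L) hgre_per hgre_sm hM hflat_re
    have hG_im := quarterTail_weighted_le (L := L) hgim_per hgim_sm hM hflat_im
    have hDg0 : 0 ≤ Dg := (norm_nonneg _).trans (hDg q)
    have h2π : (2 * π) ^ M * Dg / (2 * π) ^ M = Dg := by field_simp
    rw [h2π] at hG_re hG_im
    -- the near polynomials in the `(B,c)` currency
    obtain ⟨B₁, c₁, hB₁, hP₁', hM₁⟩ := exists_trigPoly_of_near_harmonics (L := L) (fun x => (torusFourierInv H x).re)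
    obtain ⟨B₂, c₂, hB₂, hP₂', hM₂⟩ := exists_trigPoly_of_near_harmonics (L := L) (fun x => (torusFourierInv H x).im)
    have hP₁q : ∀ q : Momentum, P₁ q = ∑ y ∈ B₁, c₁ y * Real.cos (∑ i : Fin 2, (y i : ℝ) * q i) := fun q => hP₁' (WithLp.ofLp q)
    have hP₂q : ∀ q : Momentum, P₂ q = ∑ y ∈ B₂, c₂ y * Real.cos (∑ i : Fin 2, (y i : ℝ) * q i) := fun q => hP₂' (WithLp.ofLp q)
    -- symmetry of the two products
    have hh : ∀ (x : TorusSite 2 L) (p : Fin 2 → ℝ),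
        TrigPolyC4v.harmonic (x 0).valMinAbs.natAbs (x 1).valMinAbs.natAbs ![p 0, -p 1] =
          TrigPolyC4v.harmonic (x 0).valMinAbs.natAbs (x 1).valMinAbs.natAbs p ∧
        TrigPolyC4v.harmonic (x 0).valMinAbs.natAbs (x 1).valMinAbs.natAbs ![p 1, p 0] =
          TrigPolyC4v.harmonic (x 0).valMinAbs.natAbs (x 1).valMinAbs.natAbs p :=
      fun x p => ⟨TrigPolyC4v.harmonic_reflect _ _ p, TrigPolyC4v.harmonic_swap _ _ p⟩
    have hrefl₁ : ∀ p : Fin 2 → ℝ, (fun q => gre q * P₁ q) (WithLp.toLp 2 ![p 0, -p 1]) = (fun q => gre q * P₁ q) (WithLp.toLp 2 p) := by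
      intro p; simp only [hgre, hP₁, hrefl, (hh _ p).1]
    have hswap₁ : ∀ p : Fin 2 → ℝ, (fun q => gre q * P₁ q) (WithLp.toLp 2 ![p 1, p 0]) = (fun q => gre q * P₁ q) (WithLp.toLp 2 p) := by
      intro p; simp only [hgre, hP₁, hswap, (hh _ p).2]
    have hrefl₂ : ∀ p : Fin 2 → ℝ, (fun q => gim q * P₂ q) (WithLp.toLp 2 ![p 0, -p 1]) = (fun q => gim q * P₂ q) (WithLp.toLp 2 p) := by
      intro p; simp only [hgim, hP₂, hrefl, (hh _ p).1]
    have hswap₂ : ∀ p : Fin 2 → ℝ, (fun q => gim q * P₂ q) (WithLp.toLp 2 ![p 1, p 0]) = (fun q => gim q * P₂ q) (WithLp.toLp 2 p) := by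
      intro p; simp only [hgim, hP₂, hswap, (hh _ p).2]
    -- the Leibniz terms at `q` (no vanishing at the last scale)
    have hDq0 : 0 ≤ Dq := (norm_nonneg _).trans (hDq 0 (Nat.zero_le _))
    have hJre : ‖iteratedFDeriv ℝ j (fun q => gre q * P₁ q) q‖ ≤ 2 ^ j * Dq * ∑ y ∈ B₁, |c₁ y| * (1 + |((y 0 : ℤ) : ℝ)| + |((y 1 : ℤ) : ℝ)|) ^ j :=
      norm_iteratedFDeriv_mul_cosPoly_le hgre_sm B₁ c₁ hP₁q fun i hi => ((norm_iteratedFDeriv_re_im_le hg i q).1).trans (hDq i hi)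
    have hJim : ‖iteratedFDeriv ℝ j (fun q => gim q * P₂ q) q‖ ≤ 2 ^ j * Dq * ∑ y ∈ B₂, |c₂ y| * (1 + |((y 0 : ℤ) : ℝ)| + |((y 1 : ℤ) : ℝ)|) ^ j :=
      norm_iteratedFDeriv_mul_cosPoly_le hgim_sm B₂ c₂ hP₂q fun i hi => ((norm_iteratedFDeriv_re_im_le hg i q).2).trans (hDq i hi)
    -- c4a-1's lemma, twice
    have h₁ := norm_iteratedFDeriv_evalM_symInterp_mul_trigPoly_le hgre_per hgre_sm B₁ c₁ hB₁ hP₁q hrefl₁ hswap₁ hw_re le_rfl q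
    have h₂ := norm_iteratedFDeriv_evalM_symInterp_mul_trigPoly_le hgim_per hgim_sm B₂ c₂ hB₂ hP₂q hrefl₂ hswap₂ hw_im le_rfl q
    -- the moments of the aggregated coefficients
    have hwt : ∀ x : TorusSite 2 L, 0 ≤ (1 + ((x 0).valMinAbs.natAbs : ℝ) + ((x 1).valMinAbs.natAbs : ℝ)) ^ j := fun x => by positivity
    have hMre : ∑ y ∈ B₁, |c₁ y| * (1 + |((y 0 : ℤ) : ℝ)| + |((y 1 : ℤ) : ℝ)|) ^ j ≤ Mj := by
      refine (hM₁ j).trans (le_trans ?_ hMj)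
      refine (sum_le_sum_of_subset_of_nonneg (filter_subset _ _) fun x _ _ => by positivity).trans (sum_le_sum fun x _ => ?_)
      rw [mul_comm]
      exact mul_le_mul_of_nonneg_left (Complex.abs_re_le_norm _) (hwt x)
    have hMim : ∑ y ∈ B₂, |c₂ y| * (1 + |((y 0 : ℤ) : ℝ)| + |((y 1 : ℤ) : ℝ)|) ^ j ≤ Mj := by
      refine (hM₂ j).trans (le_trans ?_ hMj)
      refine (sum_le_sum_of_subset_of_nonneg (filter_subset _ _) fun x _ _ => by positivity).trans (sum_le_sum fun x _ => ?_)
      rw [mul_comm]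
      exact mul_le_mul_of_nonneg_left (Complex.abs_im_le_norm _) (hwt x)
    have hGpos : 0 ≤ (3 : ℝ) ^ j * Dg * (2 / ((2 * (L / 4 + 1) : ℕ) : ℝ)) ^ (M - j - 4) * (2 ^ 2 * ∑' k : Fin 2 → ℤ, ∏ i, (1 + (k i : ℝ) ^ 2)⁻¹) := by
      have : 0 ≤ ∑' k : Fin 2 → ℤ, ∏ i, (1 + (k i : ℝ) ^ 2)⁻¹ := tsum_nonneg fun k => prod_nonneg fun i _ => by positivity
      positivity
    have hM1pos : 0 ≤ ∑ y ∈ B₁, |c₁ y| * (1 + |((y 0 : ℤ) : ℝ)| + |((y 1 : ℤ) : ℝ)|) ^ j := sum_nonneg fun y _ => by positivity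
    have hM2pos : 0 ≤ ∑ y ∈ B₂, |c₂ y| * (1 + |((y 0 : ℤ) : ℝ)| + |((y 1 : ℤ) : ℝ)|) ^ j := sum_nonneg fun y _ => by positivity
    have hpow0 : (0 : ℝ) ≤ 2 ^ j * Dq := by positivity
    calc ‖iteratedFDeriv ℝ j (evalM (symInterp L fun k => (fun q => gre q * P₁ q) (WithLp.toLp 2 (latticeMomentum L k)))) q‖ +
          ‖iteratedFDeriv ℝ j (evalM (symInterp L fun k => (fun q => gim q * P₂ q) (WithLp.toLp 2 (latticeMomentum L k)))) q‖
        ≤ (2 ^ j * Dq * (∑ y ∈ B₁, |c₁ y| * (1 + |((y 0 : ℤ) : ℝ)| + |((y 1 : ℤ) : ℝ)|) ^ j) +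
            2 * ((∑ y ∈ B₁, |c₁ y| * (1 + |((y 0 : ℤ) : ℝ)| + |((y 1 : ℤ) : ℝ)|) ^ j) *
            ((3 : ℝ) ^ j * Dg * (2 / ((2 * (L / 4 + 1) : ℕ) : ℝ)) ^ (M - j - 4) * (2 ^ 2 * ∑' k : Fin 2 → ℤ, ∏ i, (1 + (k i : ℝ) ^ 2)⁻¹)))) +
          (2 ^ j * Dq * (∑ y ∈ B₂, |c₂ y| * (1 + |((y 0 : ℤ) : ℝ)| + |((y 1 : ℤ) : ℝ)|) ^ j) +
            2 * ((∑ y ∈ B₂, |c₂ y| * (1 + |((y 0 : ℤ) : ℝ)| + |((y 1 : ℤ) : ℝ)|) ^ j) *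
            ((3 : ℝ) ^ j * Dg * (2 / ((2 * (L / 4 + 1) : ℕ) : ℝ)) ^ (M - j - 4) * (2 ^ 2 * ∑' k : Fin 2 → ℤ, ∏ i, (1 + (k i : ℝ) ^ 2)⁻¹)))) := by
          refine add_le_add (h₁.trans (add_le_add hJre ?_)) (h₂.trans (add_le_add hJim ?_))
          · exact mul_le_mul_of_nonneg_left (mul_le_mul_of_nonneg_left hG_re hM1pos) (by norm_num)
          · exact mul_le_mul_of_nonneg_left (mul_le_mul_of_nonneg_left hG_im hM2pos) (by norm_num)
      _ ≤ 2 * (2 ^ j * Dq * Mj) + 2 * (2 * (Mj * ((3 : ℝ) ^ j * Dg * (2 / ((2 * (L / 4 + 1) : ℕ) : ℝ)) ^ (M - j - 4) *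
            (2 ^ 2 * ∑' k : Fin 2 → ℤ, ∏ i, (1 + (k i : ℝ) ^ 2)⁻¹)))) := by
          nlinarith [mul_le_mul_of_nonneg_right hMre hGpos, mul_le_mul_of_nonneg_right hMim hGpos,
            mul_le_mul_of_nonneg_left hMre hpow0, mul_le_mul_of_nonneg_left hMim hpow0]
  · -- the far part
    have hA₀' : ∀ k : TorusSite 2 L, ‖G k‖ ≤ A₀ := fun k => hA₀ _
    have hR : (0 : ℝ) ≤ (L : ℝ) / 4 := by positivity
    have hT : ∑ x ∈ far, ‖torusFourierInv H x‖ ≤ Ms / (1 + (L : ℝ) / 4) ^ s := by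
      have h := sum_far_momentWeight_norm_torusFourierInv_le H (j := 0) (s := s) (Nat.zero_le _) hR hMs
      simp only [pow_zero, one_mul, Nat.sub_zero] at h
      exact (sum_le_sum_of_subset_of_nonneg farSites_subset fun x _ _ => norm_nonneg _).trans h
    exact norm_iteratedFDeriv_evalM_symInterp_farHarmonics_le G hA₀' (torusFourierInv H) far hT j q

end Last


end Summit.HubbardSuperconductivity.HubbardSuperconductivity.Theorems.EngineV8

end
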